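import Summits.QuantumFields.YangMills.Theorems.VirialFluxGapRingFrameBlockCalculus
import Summits.QuantumFields.YangMills.Theorems.VirialFluxGapResolventFieldPointwise
import HarnessLib

/-!
# Route `VirialFluxGap` (YangMills): POLYNOMIAL (in `L`) BOUNDS FOR THE THIRD FRAME DERIVATIVES OF THE ZERO-FLUX RING DEFICIT
# (the constants `K₁, K₂, K₃` of the resolvent Euler field)

Toward the deciding crux `VirialFluxGap.PeriodicSoftness` (item stmt-QuantumFields-24141), generic-region Euler field (memo
`fcl-p3-g40-RESOLVENT-EULER-FIELD-24141.md`).  The pointwise package ✓`FrameHessian.pointwise_taylor_package` takes sup bounds on third frame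
derivatives `∂_{Y¹}∂_{Y²}∂_{Y³} ringPoly` over the ring space; the window arithmetic forces them to be POLYNOMIAL in `L`.  Here:

* §1 the three TERM SHAPES of `ringPoly` as fixed smooth block functions — temporal bond `tb(A) = 2 − Re tr(A₀A₁ᴴ)` on `(M₂)²`, seam bond
  `sm(A) = 2 − Re tr(A₀(A₁A₂A₃ᴴ)ᴴ)` and plaquette `pq(A) = 2 − Re tr(A₀A₁A₂ᴴA₃ᴴ)` on `(M₂)⁴` — and their coordinate tuples; ★ `ringPoly_eq_sum_terms`:
  `ringPoly = Σ_t shape_t ∘ projK v_t` over the term index `T_L = (slices×edges ⊕ edges) ⊕ slices×plaquettes`;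
* §2 `frameD3_fun_sum` — third frame derivatives of finite sums of smooth functions; ★ `card_terms_le` — `#T_L ≤ 27·L⁴`;
* §3 ★★★ `exists_bound_frameD3_ringPoly` — there is an ABSOLUTE constant `C ≥ 0` such that for every `L`, every ring history `Q` and all
  direction assignments with `‖Yⁱ_w‖ ≤ bᵢ` (all variables `w`):  `|∂_{Y¹}∂_{Y²}∂_{Y³} ringPoly (ringCoord Q)| ≤ C·L⁴·b₁b₂b₃`
  (✓`frameD3_comp_projK` + ✓`exists_bound_frameDK3` per shape + the count).

HONEST FRAMING: calculus bookkeeping with a non-explicit absolute constant; second/first-order companions and the basis normalisation `|u|` are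
routine corollaries not included; ⟨24141⟩ stays OPEN; no stub / crux / rung / summit is closed; the Yang–Mills mass gap is NOT proved; no summit is
proved by a line.  Definitions (`tbShape`, `seamShape`, `plaqShape`, `vTB`, `vSeam`, `vPlaq`, `termFun`) are problem-side plumbing (no `Prop`);
0 `sorry`, standard axioms.  Explicit-unit seat `ym-line-fcl-p3` g40 (cell ym-idea-1, free hands), `--supports stmt-QuantumFields-24141`.
References: [folklore].
-/

set_option autoImplicit false

noncomputable section

open scoped Matrix BigOperators ContDiff Topology
open MeasureTheory Set
open Literature.MathematicalPhysics.QuantumFieldTheory hiding SU2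
open Literature.MathematicalPhysics.QuantumLattice
open Literature.MathematicalPhysics.QuantumFieldTheory.SUNBakryEmery (expSU coe_expSU matTop)

namespace Summit.QuantumFields.YangMills.Theorems.VirialFluxGap.FrameHessian

open Summit.QuantumFields.YangMills.Theorems.FemtoTransferGap
open Summit.QuantumFields.YangMills.Theorems.FemtoTransferGap.TT
open Summit.QuantumFields.YangMills.Theorems.VirialFluxGap.RingDeficit
open Summit.QuantumFields.YangMills.Theorems.VirialFluxGap.FrameDerivative

open scoped Matrix.Norms.Frobenius

attribute [local instance 2000] Literature.MathematicalPhysics.QuantumFieldTheory.SUNBakryEmery.matTop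

/-! ## §1 The three term shapes and the term decomposition of `ringPoly` -/

/-- Temporal-bond shape `2 − Re tr(A₀ A₁ᴴ)`. [folklore] -/
def tbShape (A : Fin 2 → Matrix (Fin 2) (Fin 2) ℂ) : ℝ := 2 - ((A 0 * (A 1)ᴴ).trace).re

/-- Seam-bond shape `2 − Re tr(A₀ (A₁ A₂ A₃ᴴ)ᴴ)`. [folklore] -/
def seamShape (A : Fin 4 → Matrix (Fin 2) (Fin 2) ℂ) : ℝ := 2 - ((A 0 * (A 1 * A 2 * (A 3)ᴴ)ᴴ).trace).re

/-- Plaquette shape `2 − Re tr(A₀ A₁ A₂ᴴ A₃ᴴ)`. [folklore] -/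
def plaqShape (A : Fin 4 → Matrix (Fin 2) (Fin 2) ℂ) : ℝ := 2 - ((A 0 * A 1 * (A 2)ᴴ * (A 3)ᴴ).trace).re

/-- A block slot is a smooth function of the block. [folklore] -/
theorem contDiff_slot {k : ℕ} (i : Fin k) : ContDiff ℝ ∞ fun A : Fin k → Matrix (Fin 2) (Fin 2) ℂ => A i :=
  contDiff_apply ℝ (Matrix (Fin 2) (Fin 2) ℂ) i

/-- The temporal-bond shape is smooth. [folklore] -/
theorem contDiff_tbShape : ContDiff ℝ ∞ tbShape := by
  unfold tbShape
  exact contDiff_const.sub (contDiff_reTr.comp ((contDiff_slot 0).mul (contDiff_conjTranspose.comp (contDiff_slot 1))))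

/-- The seam-bond shape is smooth. [folklore] -/
theorem contDiff_seamShape : ContDiff ℝ ∞ seamShape := by
  unfold seamShape
  exact contDiff_const.sub (contDiff_reTr.comp ((contDiff_slot 0).mul (contDiff_conjTranspose.comp
    (((contDiff_slot 1).mul (contDiff_slot 2)).mul (contDiff_conjTranspose.comp (contDiff_slot 3))))))

/-- The plaquette shape is smooth. [folklore] -/
theorem contDiff_plaqShape : ContDiff ℝ ∞ plaqShape := by
  unfold plaqShape
  exact contDiff_const.sub (contDiff_reTr.comp ((((contDiff_slot 0).mul (contDiff_slot 1)).mul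
    (contDiff_conjTranspose.comp (contDiff_slot 2))).mul (contDiff_conjTranspose.comp (contDiff_slot 3))))

variable {L : ℕ} [NeZero L]

omit [NeZero L] in
/-- Coordinate tuple of a temporal bond. [folklore] -/
def vTB (i : Fin (2 * L - 1)) (e : Edge 3 L) : Fin 2 → ((Fin (2 * L - 1 + 1) × Edge 3 L) ⊕ Site 3 L) := ![Sum.inl (i.castSucc, e), Sum.inl (i.succ, e)]

/-- Coordinate tuple of a seam bond. [folklore] -/
def vSeam (e : Edge 3 L) : Fin 4 → ((Fin (2 * L - 1 + 1) × Edge 3 L) ⊕ Site 3 L) := ![Sum.inl (Fin.last (2 * L - 1), e), Sum.inr e.1, Sum.inl (0, e), Sum.inr (e.1.shift e.2)]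

/-- Coordinate tuple of a plaquette of slice `j`. [folklore] -/
def vPlaq (j : Fin (2 * L - 1 + 1)) (p : Plaquette 3 L) : Fin 4 → ((Fin (2 * L - 1 + 1) × Edge 3 L) ⊕ Site 3 L) :=
  ![Sum.inl (j, (p.1, p.2.1.1)), Sum.inl (j, (p.1.shift p.2.1.1, p.2.1.2)), Sum.inl (j, (p.1.shift p.2.1.2, p.2.1.1)),
    Sum.inl (j, (p.1, p.2.1.2))]

/-- The term functions of `ringPoly`, indexed by `((slices × edges) ⊕ edges) ⊕ (slices × plaquettes)`. [folklore] -/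
def termFun (L : ℕ) [NeZero L] :
    ((Fin (2 * L - 1) × Edge 3 L) ⊕ Edge 3 L) ⊕ (Fin (2 * L - 1 + 1) × Plaquette 3 L) → ((Fin (2 * L - 1 + 1) → Edge 3 L → Matrix (Fin 2) (Fin 2) ℂ) × (Site 3 L → Matrix (Fin 2) (Fin 2) ℂ)) → ℝ
  | Sum.inl (Sum.inl ie) => fun M => tbShape (projK (vTB ie.1 ie.2) M)
  | Sum.inl (Sum.inr e) => fun M => seamShape (projK (vSeam e) M)
  | Sum.inr jp => fun M => plaqShape (projK (vPlaq jp.1 jp.2) M)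

/-- Every term function is smooth. [folklore] -/
theorem contDiff_termFun (t : ((Fin (2 * L - 1) × Edge 3 L) ⊕ Edge 3 L) ⊕ (Fin (2 * L - 1 + 1) × Plaquette 3 L)) :
    ContDiff ℝ ∞ (termFun L t) := by
  rcases t with (ie | e) | jp
  · exact contDiff_comp_projK contDiff_tbShape _
  · exact contDiff_comp_projK contDiff_seamShape _
  · exact contDiff_comp_projK contDiff_plaqShape _

/-- ★ **The deficit polynomial is the sum of its term functions.** [folklore] -/
theorem ringPoly_eq_sum_terms : ringPoly L = fun M : ((Fin (2 * L - 1 + 1) → Edge 3 L → Matrix (Fin 2) (Fin 2) ℂ) × (Site 3 L → Matrix (Fin 2) (Fin 2) ℂ)) => ∑ t, termFun L t M := by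
  funext M
  rw [Fintype.sum_sum_type, Fintype.sum_sum_type, ringPoly]
  simp only [termFun, tbShape, seamShape, plaqShape, projK, coordAt, vTB, vSeam, vPlaq, Matrix.cons_val_zero, Matrix.cons_val_one,
    Matrix.cons_val, Fintype.sum_prod_type]

/-! ## §2 Third frame derivatives of finite sums; the term count -/

/-- Third frame derivatives of a finite sum of smooth functions of the coordinates. [folklore] -/
theorem frameD3_fun_sum {ι : Type*} [Fintype ι] (Y₁ Y₂ Y₃ : ((Fin (2 * L - 1 + 1) × Edge 3 L) ⊕ Site 3 L) → Matrix (Fin 2) (Fin 2) ℂ) {h : ι → ((Fin (2 * L - 1 + 1) → Edge 3 L → Matrix (Fin 2) (Fin 2) ℂ) × (Site 3 L → Matrix (Fin 2) (Fin 2) ℂ)) → ℝ}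
    (hh : ∀ t, ContDiff ℝ ∞ (h t)) (M : ((Fin (2 * L - 1 + 1) → Edge 3 L → Matrix (Fin 2) (Fin 2) ℂ) × (Site 3 L → Matrix (Fin 2) (Fin 2) ℂ))) :
    frameD Y₁ (frameD Y₂ (frameD Y₃ (fun M' => ∑ t, h t M'))) M = ∑ t, frameD Y₁ (frameD Y₂ (frameD Y₃ (h t))) M := by
  have e3 : frameD Y₃ (fun M' : ((Fin (2 * L - 1 + 1) → Edge 3 L → Matrix (Fin 2) (Fin 2) ℂ) × (Site 3 L → Matrix (Fin 2) (Fin 2) ℂ)) => ∑ t, h t M') = fun M' => ∑ t, (1 : ℝ) * frameD Y₃ (h t) M' := by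
    funext M'
    have := frameD_fun_sum Y₃ (fun _ => (1 : ℝ)) hh M'
    simp only [one_mul] at this ⊢
    exact this
  have hh3 : ∀ t, ContDiff ℝ ∞ (frameD Y₃ (h t)) := fun t => contDiff_frameD (hh t) Y₃
  have e2 : frameD Y₂ (frameD Y₃ (fun M' : ((Fin (2 * L - 1 + 1) → Edge 3 L → Matrix (Fin 2) (Fin 2) ℂ) × (Site 3 L → Matrix (Fin 2) (Fin 2) ℂ)) => ∑ t, h t M')) = fun M' => ∑ t, (1 : ℝ) * frameD Y₂ (frameD Y₃ (h t)) M' := by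
    rw [e3]; funext M'
    rw [frameD_fun_sum Y₂ (fun _ => (1 : ℝ)) hh3 M']
  have hh2 : ∀ t, ContDiff ℝ ∞ (frameD Y₂ (frameD Y₃ (h t))) := fun t => contDiff_frameD (hh3 t) Y₂
  rw [e2, frameD_fun_sum Y₁ (fun _ => (1 : ℝ)) hh2 M]
  simp only [one_mul]

/-- ★ The number of terms is at most `27·L⁴`: `(2L−1)·3L³ + 3L³ + 2L·#plaquettes ≤ 6L⁴ + 3L⁴ + 18L⁴`. [folklore] -/
theorem card_terms_le :
    (Fintype.card (((Fin (2 * L - 1) × Edge 3 L) ⊕ Edge 3 L) ⊕ (Fin (2 * L - 1 + 1) × Plaquette 3 L)) : ℝ) ≤ 27 * (L : ℝ) ^ 4 := by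
  have hL : 1 ≤ L := NeZero.one_le
  have hLr : (1 : ℝ) ≤ L := by exact_mod_cast hL
  have hsub : (Fintype.card {p : Fin 3 × Fin 3 // p.1 < p.2} : ℝ) ≤ 9 := by
    have h : Fintype.card {p : Fin 3 × Fin 3 // p.1 < p.2} ≤ Fintype.card (Fin 3 × Fin 3) := Fintype.card_subtype_le _
    rw [Fintype.card_prod, Fintype.card_fin] at h
    exact_mod_cast h
  have h2L : ((2 * L - 1 : ℕ) : ℝ) ≤ 2 * L := by
    have : 2 * L - 1 ≤ 2 * L := Nat.sub_le _ _
    exact_mod_cast this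
  have h2L' : ((2 * L - 1 + 1 : ℕ) : ℝ) = 2 * L := by
    have : 2 * L - 1 + 1 = 2 * L := by omega
    rw [this]; push_cast; ring
  have hT : (Fintype.card (((Fin (2 * L - 1) × Edge 3 L) ⊕ Edge 3 L) ⊕ (Fin (2 * L - 1 + 1) × Plaquette 3 L)) : ℝ) =
      ((2 * L - 1 : ℕ) : ℝ) * ((L : ℝ) ^ 3 * 3) + (L : ℝ) ^ 3 * 3 +
        ((2 * L - 1 + 1 : ℕ) : ℝ) * ((L : ℝ) ^ 3 * (Fintype.card {p : Fin 3 × Fin 3 // p.1 < p.2} : ℝ)) := by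
    simp only [Fintype.card_sum, Fintype.card_prod, Fintype.card_fun, ZMod.card, Fintype.card_fin]
    push_cast
    ring
  rw [hT, h2L']
  have hc0 : (0 : ℝ) ≤ Fintype.card {p : Fin 3 × Fin 3 // p.1 < p.2} := by positivity
  have hL3 : (0 : ℝ) ≤ (L : ℝ) ^ 3 := by positivity
  have hL34 : (L : ℝ) ^ 3 ≤ (L : ℝ) ^ 4 := by
    calc (L : ℝ) ^ 3 = (L : ℝ) ^ 3 * 1 := (mul_one _).symm
      _ ≤ (L : ℝ) ^ 3 * L := mul_le_mul_of_nonneg_left hLr hL3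
      _ = (L : ℝ) ^ 4 := by ring
  nlinarith [mul_le_mul_of_nonneg_right h2L (by positivity : (0 : ℝ) ≤ (L : ℝ) ^ 3 * 3),
    mul_le_mul_of_nonneg_left hsub (by positivity : (0 : ℝ) ≤ 2 * (L : ℝ) * (L : ℝ) ^ 3)]

/-! ## §3 The polynomial bound -/

/-- The coordinates of a ring history are special unitary, slot by slot. [folklore] -/
theorem projK_ringCoord_mem {k : ℕ} (v : Fin k → ((Fin (2 * L - 1 + 1) × Edge 3 L) ⊕ Site 3 L)) (Q : ((Fin (2 * L - 1 + 1) → GaugeConfig 3 L SU2) × (Site 3 L → SU2))) (i : Fin k) :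
    projK v (ringCoord L Q) i ∈ Set.range (fun U : SU2 => (U : Matrix (Fin 2) (Fin 2) ℂ)) := by
  unfold projK coordAt ringCoord
  rcases v i with ⟨j, e⟩ | x
  · exact ⟨Q.1 j e, rfl⟩
  · exact ⟨Q.2 x, rfl⟩

/-- ★★★ **Polynomial third-derivative bound for the deficit**: there is an absolute constant `C ≥ 0` such that for every `L`, every ring
history `Q`, all direction assignments `Y¹, Y², Y³` with `‖Yⁱ_w‖ ≤ bᵢ` (`bᵢ ≥ 0`) at every variable:
`|∂_{Y¹}∂_{Y²}∂_{Y³} ringPoly (ringCoord Q)| ≤ C·L⁴·b₁·b₂·b₃`. [folklore] -/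
theorem exists_bound_frameD3_ringPoly :
    ∃ C : ℝ, 0 ≤ C ∧ ∀ (L : ℕ) [NeZero L] (Q : ((Fin (2 * L - 1 + 1) → GaugeConfig 3 L SU2) × (Site 3 L → SU2)))
      (Y₁ Y₂ Y₃ : ((Fin (2 * L - 1 + 1) × Edge 3 L) ⊕ Site 3 L) → Matrix (Fin 2) (Fin 2) ℂ) (b₁ b₂ b₃ : ℝ), 0 ≤ b₁ → 0 ≤ b₂ → 0 ≤ b₃ →
      (∀ w, ‖Y₁ w‖ ≤ b₁) → (∀ w, ‖Y₂ w‖ ≤ b₂) → (∀ w, ‖Y₃ w‖ ≤ b₃) →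
      |frameD Y₁ (frameD Y₂ (frameD Y₃ (ringPoly L))) (ringCoord L Q)| ≤ C * (L : ℝ) ^ 4 * b₁ * b₂ * b₃ := by
  obtain ⟨Ctb, hCtb0, hCtb⟩ := exists_bound_frameDK3 contDiff_tbShape
  obtain ⟨Csm, hCsm0, hCsm⟩ := exists_bound_frameDK3 contDiff_seamShape
  obtain ⟨Cpq, hCpq0, hCpq⟩ := exists_bound_frameDK3 contDiff_plaqShape
  refine ⟨27 * (Ctb + Csm + Cpq), by positivity, ?_⟩
  intro L _ Q Y₁ Y₂ Y₃ b₁ b₂ b₃ hb₁ hb₂ hb₃ hY₁ hY₂ hY₃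
  have hbbb : 0 ≤ b₁ * b₂ * b₃ := by positivity
  -- termwise bound by the maximal shape constant
  have hterm : ∀ t, |frameD Y₁ (frameD Y₂ (frameD Y₃ (termFun L t))) (ringCoord L Q)| ≤ (Ctb + Csm + Cpq) * (b₁ * b₂ * b₃) := by
    intro t
    rcases t with (⟨i, e⟩ | e) | ⟨j, p⟩
    · have h := frameD3_comp_projK contDiff_tbShape (vTB i e) Y₁ Y₂ Y₃ (ringCoord L Q)
      have hb := hCtb (projK (vTB i e) (ringCoord L Q)) (projK_ringCoord_mem _ Q) (fun i' => Y₁ (vTB i e i'))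
        (fun i' => Y₂ (vTB i e i')) (fun i' => Y₃ (vTB i e i')) b₁ b₂ b₃ hb₁ hb₂ hb₃ (fun _ => hY₁ _) (fun _ => hY₂ _) (fun _ => hY₃ _)
      calc |frameD Y₁ (frameD Y₂ (frameD Y₃ (termFun L (Sum.inl (Sum.inl (i, e)))))) (ringCoord L Q)|
          = |frameDK (fun i' => Y₁ (vTB i e i')) (frameDK (fun i' => Y₂ (vTB i e i')) (frameDK (fun i' => Y₃ (vTB i e i')) tbShape))
              (projK (vTB i e) (ringCoord L Q))| := by rw [← h]; rfl
        _ ≤ Ctb * b₁ * b₂ * b₃ := hb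
        _ ≤ (Ctb + Csm + Cpq) * (b₁ * b₂ * b₃) := by nlinarith
    · have h := frameD3_comp_projK contDiff_seamShape (vSeam e) Y₁ Y₂ Y₃ (ringCoord L Q)
      have hb := hCsm (projK (vSeam e) (ringCoord L Q)) (projK_ringCoord_mem _ Q) (fun i' => Y₁ (vSeam e i'))
        (fun i' => Y₂ (vSeam e i')) (fun i' => Y₃ (vSeam e i')) b₁ b₂ b₃ hb₁ hb₂ hb₃ (fun _ => hY₁ _) (fun _ => hY₂ _) (fun _ => hY₃ _)
      calc |frameD Y₁ (frameD Y₂ (frameD Y₃ (termFun L (Sum.inl (Sum.inr e))))) (ringCoord L Q)|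
          = |frameDK (fun i' => Y₁ (vSeam e i')) (frameDK (fun i' => Y₂ (vSeam e i')) (frameDK (fun i' => Y₃ (vSeam e i')) seamShape))
              (projK (vSeam e) (ringCoord L Q))| := by rw [← h]; rfl
        _ ≤ Csm * b₁ * b₂ * b₃ := hb
        _ ≤ (Ctb + Csm + Cpq) * (b₁ * b₂ * b₃) := by nlinarith
    · have h := frameD3_comp_projK contDiff_plaqShape (vPlaq j p) Y₁ Y₂ Y₃ (ringCoord L Q)
      have hb := hCpq (projK (vPlaq j p) (ringCoord L Q)) (projK_ringCoord_mem _ Q) (fun i' => Y₁ (vPlaq j p i'))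
        (fun i' => Y₂ (vPlaq j p i')) (fun i' => Y₃ (vPlaq j p i')) b₁ b₂ b₃ hb₁ hb₂ hb₃ (fun _ => hY₁ _) (fun _ => hY₂ _) (fun _ => hY₃ _)
      calc |frameD Y₁ (frameD Y₂ (frameD Y₃ (termFun L (Sum.inr (j, p))))) (ringCoord L Q)|
          = |frameDK (fun i' => Y₁ (vPlaq j p i')) (frameDK (fun i' => Y₂ (vPlaq j p i')) (frameDK (fun i' => Y₃ (vPlaq j p i')) plaqShape))
              (projK (vPlaq j p) (ringCoord L Q))| := by rw [← h]; rfl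
        _ ≤ Cpq * b₁ * b₂ * b₃ := hb
        _ ≤ (Ctb + Csm + Cpq) * (b₁ * b₂ * b₃) := by nlinarith
  -- sum over the terms
  rw [ringPoly_eq_sum_terms, frameD3_fun_sum Y₁ Y₂ Y₃ (contDiff_termFun (L := L)) (ringCoord L Q)]
  have hcard := card_terms_le (L := L)
  calc |∑ t, frameD Y₁ (frameD Y₂ (frameD Y₃ (termFun L t))) (ringCoord L Q)|
      ≤ ∑ t, |frameD Y₁ (frameD Y₂ (frameD Y₃ (termFun L t))) (ringCoord L Q)| := Finset.abs_sum_le_sum_abs _ _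
    _ ≤ ∑ _t : ((Fin (2 * L - 1) × Edge 3 L) ⊕ Edge 3 L) ⊕ (Fin (2 * L - 1 + 1) × Plaquette 3 L), (Ctb + Csm + Cpq) * (b₁ * b₂ * b₃) :=
        Finset.sum_le_sum fun t _ => hterm t
    _ = (Fintype.card (((Fin (2 * L - 1) × Edge 3 L) ⊕ Edge 3 L) ⊕ (Fin (2 * L - 1 + 1) × Plaquette 3 L)) : ℝ) *
          ((Ctb + Csm + Cpq) * (b₁ * b₂ * b₃)) := by simp
    _ ≤ 27 * (L : ℝ) ^ 4 * ((Ctb + Csm + Cpq) * (b₁ * b₂ * b₃)) :=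
        mul_le_mul_of_nonneg_right hcard (by positivity)
    _ = 27 * (Ctb + Csm + Cpq) * (L : ℝ) ^ 4 * b₁ * b₂ * b₃ := by ring

end Summit.QuantumFields.YangMills.Theorems.VirialFluxGap.FrameHessian

end
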